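import Literature.NumberTheory.Sieve.SmoothCountSaddle
import HarnessLib

/-!
# Rankin at the master saddle point and the saddle size at a divided scale `x/g`

Topic `Literature/NumberTheory/Sieve` (smooth numbers); a PROVED tool file in the vocabulary of
`SmoothSaddlePoint.lean` (`saddlePoint = α(x, y)`, `smoothZeta = ζ(σ, y)`), `SmoothSaddlePointPhi.lean`
(`saddlePhi₂ = φ₂(σ, y)`) and `SmoothCountSaddle.lean` (`Ψ(x, y) ≍ 𝓟(x) = x^{α} ζ(α, y)/√φ₂(α, y)`,
`α = α(x, y)`, in the range `(log x)^4 ≤ y ≤ exp((log x)^{1/5})`). Counting smooth numbers `≤ x` with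
coprimality or congruence conditions one meets `Ψ(x/g, y)` and `𝓟(x/g)` at divided scales `x/g`; here
they are compared with `g^{-α(x,y)}` times the quantity at `x`, keeping the MASTER saddle point `α(x, y)`:

* `card_smoothNumbersUpTo_floor_le_rankin`, `card_smoothNumbersUpTo_div_le_rankin_saddlePoint` —
  Rankin's bound `Ψ(z, y) ≤ z^σ ζ(σ, y)` [HildebrandTenenbaum1986, (2.1)] at a real `z ≥ 0`, and at
  `z = x/g`, `σ = α(x, y)`: **`Ψ(x/g, y) ≤ g^{-α} x^{α} ζ(α, y)`** (`x > 1`, `y ≥ 2`, `g > 0`);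
* `saddlePhi₂_saddlePoint_le_mul_div`, `saddlePhi₂_saddlePoint_div_le` — for `1 ≤ g ≤ √x` in the
  range, `φ₂(α(x/g, y), y) ≤ φ₂(α(x, y), y) ≤ C φ₂(α(x/g, y), y)` (both are `≍ log x · log y`
  [HildebrandTenenbaum1986, (2.5)]; `α(x) ≤ α(x/g)` and `φ₂` decreases);
* `saddleSize_div_le` (real `g`), `saddleSize_div_nat_le` — **`𝓟(x/g) ≤ C g^{-α(x,y)} 𝓟(x)`** for
  `1 ≤ g ≤ √x`: the numerator by the minimality of Rankin's bound at the saddle point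
  [HildebrandTenenbaum1986, §2 after (2.1)] (`(x/g)^{α(x/g)} ζ(α(x/g)) ≤ (x/g)^{α} ζ(α) = g^{-α} x^{α} ζ(α)`),
  the denominator by the previous item;
* `card_smoothNumbersUpTo_div_le_mul_card` — **`Ψ(x/g, y) ≤ 50 √(φ₂(α, y)) g^{-α} Ψ(x, y)
  ≤ 50 √(3 log x log y) g^{-α} Ψ(x, y)`** for every `g > 0` (Rankin at the master saddle point and the
  lower half of [HildebrandTenenbaum1986, Thm 1], `card_smoothNumbersUpTo_two_sided`) — a crude form
  of "Smooth Numbers Result 2" `Ψ(x/d, y) ≪ d^{-α} Ψ(x, y)` [Harper2016, §2.1] losing `√(log x log y)`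
  but valid for `log y ≤ (log x)^{1/5}` (loss-free for `log y ≤ (log x)^{1/6}`:
  `card_smoothNumbersUpTo_le_rpow_mul_card` in `SmoothCountLocal`);
* `scale_compare` — the above packaged with one constant and one threshold, `g : ℕ`.

## References

* [HildebrandTenenbaum1986] A. Hildebrand, G. Tenenbaum, *On integers free of large prime factors*,
  Trans. Amer. Math. Soc. 296 (1986) 265–290: §2 (2.1)–(2.2), Thm 1 (2.3), Thm 2 (2.5).
* [Harper2016] A. J. Harper, Compositio Math. 152 (2016) 1121–1158, §2.1 (Smooth Numbers Results 1–2).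
* [MontgomeryVaughan2007] H. L. Montgomery, R. C. Vaughan, *Multiplicative Number Theory I*, §7.1 (7.17).
-/

noncomputable section

open Real Finset

namespace Literature.NumberTheory.Sieve

variable {x z g σ : ℝ} {y : ℕ}

/-! ### Rankin's bound at a real point and at the master saddle point -/

/-- **Rankin's bound at a real point**: `Ψ(z, y) ≤ z^σ ζ(σ, y)` for `z ≥ 0`, `σ > 0`, where
`Ψ(z, y) = #Nat.smoothNumbersUpTo ⌊z⌋ (y+1)` counts the `1 ≤ n ≤ z` with all prime factors `≤ y`
(the tree's `card_smoothNumbersUpTo_le_rankin`, Montgomery–Vaughan (7.17), and `⌊z⌋^σ ≤ z^σ`).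
[cite: MontgomeryVaughan2007, §7.1 (7.17)] -/
theorem card_smoothNumbersUpTo_floor_le_rankin (hz : 0 ≤ z) (hσ : 0 < σ) (y : ℕ) :
    ((Nat.smoothNumbersUpTo ⌊z⌋₊ (y + 1)).card : ℝ) ≤ z ^ σ * smoothZeta σ y := by
  have h := card_smoothNumbersUpTo_le_rankin ⌊z⌋₊ (y + 1) hσ
  rw [← smoothZeta_eq_prod_primesBelow] at h
  refine h.trans (mul_le_mul_of_nonneg_right ?_ (smoothZeta_pos hσ).le)
  exact Real.rpow_le_rpow (Nat.cast_nonneg _) (Nat.floor_le hz) hσ.le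

/-- **Rankin at the master saddle point**: `Ψ(x/g, y) ≤ g^{-α} · x^{α} ζ(α, y)` with `α = α(x, y)` the
saddle point OF `x` (`x > 1`, `y ≥ 2`, real `g > 0`): Rankin's bound `Ψ(z, y) ≤ z^σ ζ(σ, y)`
[HildebrandTenenbaum1986, (2.1)] at `z = x/g`, `σ = α(x, y)`, and `(x/g)^α = g^{-α} x^α`.
[cite: HildebrandTenenbaum1986, §2 (2.1)] -/
theorem card_smoothNumbersUpTo_div_le_rankin_saddlePoint (hx : 1 < x) (hy : 2 ≤ y) (hg : 0 < g) :
    ((Nat.smoothNumbersUpTo ⌊x / g⌋₊ (y + 1)).card : ℝ) ≤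
      g ^ (-saddlePoint x y) * (x ^ saddlePoint x y * smoothZeta (saddlePoint x y) y) := by
  have hα : 0 < saddlePoint x y := saddlePoint_pos hx hy
  have hx0 : 0 ≤ x := by linarith
  have h := card_smoothNumbersUpTo_floor_le_rankin (div_nonneg hx0 hg.le) hα y
  have heq : (x / g) ^ saddlePoint x y = g ^ (-saddlePoint x y) * x ^ saddlePoint x y := by
    rw [Real.div_rpow hx0 hg.le, Real.rpow_neg hg.le, div_eq_mul_inv, mul_comm]
  calc ((Nat.smoothNumbersUpTo ⌊x / g⌋₊ (y + 1)).card : ℝ)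
      ≤ (x / g) ^ saddlePoint x y * smoothZeta (saddlePoint x y) y := h
    _ = g ^ (-saddlePoint x y) * (x ^ saddlePoint x y * smoothZeta (saddlePoint x y) y) := by
        rw [heq, mul_assoc]

/-- **Rankin at the master saddle point, natural divisor**: `Ψ(x/g, y) ≤ g^{-α(x,y)} x^{α(x,y)} ζ(α(x,y), y)`
for `g : ℕ`, `g ≥ 1` (`x > 1`, `y ≥ 2`). [cite: HildebrandTenenbaum1986, §2 (2.1)] -/
theorem card_smoothNumbersUpTo_div_nat_le_rankin_saddlePoint {g : ℕ} (hx : 1 < x) (hy : 2 ≤ y)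
    (hg : 1 ≤ g) :
    ((Nat.smoothNumbersUpTo ⌊x / g⌋₊ (y + 1)).card : ℝ) ≤
      (g : ℝ) ^ (-saddlePoint x y) * (x ^ saddlePoint x y * smoothZeta (saddlePoint x y) y) :=
  card_smoothNumbersUpTo_div_le_rankin_saddlePoint hx hy (Nat.cast_pos.2 (by omega))

/-! ### The range `(log x)^4 ≤ y ≤ exp((log x)^{1/5})` and the divided scales `x/g`, `g ≤ √x` -/

/-- Bookkeeping in the range `x ≥ e^{16}`, `(log x)^4 ≤ y`, `log y ≤ (log x)^{1/5}`: `log x ≥ 16`,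
`x > 1`, `y ≥ 2`, `log y > 0`, `(log x)^3 ≤ y`, and `y ≤ √x ≤ x` (as `(log x)^{1/5} ≤ (log x)/2`).
[folklore] -/
theorem scaleRange_aux (hx : Real.exp 16 ≤ x) (hy4 : Real.log x ^ 4 ≤ y)
    (hylog : Real.log y ≤ Real.log x ^ (1 / 5 : ℝ)) :
    16 ≤ Real.log x ∧ 1 < x ∧ 2 ≤ y ∧ 0 < Real.log y ∧ Real.log x ^ 3 ≤ y ∧
      (y : ℝ) ≤ x ^ (1 / 2 : ℝ) ∧ x ^ (1 / 2 : ℝ) ≤ x := by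
  have hx0 : 0 < x := lt_of_lt_of_le (Real.exp_pos 16) hx
  set L : ℝ := Real.log x with hL
  have hL16 : 16 ≤ L := by
    have := Real.log_le_log (Real.exp_pos 16) hx
    rwa [Real.log_exp] at this
  have hx1 : 1 < x := lt_of_lt_of_le (Real.one_lt_exp_iff.2 (by norm_num)) hx
  have hL1 : 1 ≤ L := by linarith
  have hL0 : 0 < L := by linarith
  have hy3 : L ^ 3 ≤ y := (pow_le_pow_right₀ hL1 (by norm_num : 3 ≤ 4)).trans hy4
  have hL4 : (16 : ℝ) ^ 4 ≤ L ^ 4 := pow_le_pow_left₀ (by norm_num) hL16 4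
  have hy_ge : (65536 : ℝ) ≤ y := by norm_num at hL4; linarith
  have hy2 : 2 ≤ y := by exact_mod_cast (show (2 : ℝ) ≤ y by linarith)
  have hy0 : (0 : ℝ) < y := by linarith
  have hlogy : 0 < Real.log y := Real.log_pos (by linarith)
  -- `r = L^{1/5} ≥ 3/2`, so `L = r · r^4 ≥ 2 r`
  set r : ℝ := L ^ (1 / 5 : ℝ) with hr
  have hr0 : 0 < r := Real.rpow_pos_of_pos hL0 _
  have hr5 : r ^ 5 = L := by
    rw [hr, ← Real.rpow_natCast, ← Real.rpow_mul hL0.le]; norm_num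
  have hr32 : 3 / 2 ≤ r := by
    by_contra h
    push Not at h
    have h5 : r ^ 5 < (3 / 2 : ℝ) ^ 5 := pow_lt_pow_left₀ h hr0.le (by norm_num)
    norm_num at h5
    linarith
  have hrL : r ≤ L / 2 := by
    have h4 : (3 / 2 : ℝ) ^ 4 ≤ r ^ 4 := pow_le_pow_left₀ (by norm_num) hr32 4
    have hLr : L = r * r ^ 4 := by rw [← hr5]; ring
    norm_num at h4
    nlinarith
  have hy_le : (y : ℝ) ≤ x ^ (1 / 2 : ℝ) := by
    rw [Real.rpow_def_of_pos hx0]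
    calc (y : ℝ) = Real.exp (Real.log y) := (Real.exp_log hy0).symm
      _ ≤ Real.exp (Real.log x * (1 / 2)) := Real.exp_le_exp.2 (by linarith)
  have hsqrt_le : x ^ (1 / 2 : ℝ) ≤ x :=
    (Real.rpow_le_rpow_of_exponent_le hx1.le (by norm_num : (1 / 2 : ℝ) ≤ 1)).trans_eq (Real.rpow_one x)
  exact ⟨hL16, hx1, hy2, hlogy, hy3, hy_le, hsqrt_le⟩

/-- Bookkeeping at a divided scale: for `x ≥ e^{16}`, `(log x)^4 ≤ y`, `log y ≤ (log x)^{1/5}` and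
`1 ≤ g ≤ √x`, the scale `z = x/g` satisfies `√x ≤ z ≤ x`, `z > 1`, `(log x)/2 ≤ log z ≤ log x`,
`(log z)^3 ≤ y ≤ z` — so `z` lies in the range `(log z)^3 ≤ y ≤ z` of the tree's estimates for
`φ₂(α(z, y), y)`. [folklore] -/
theorem scaleRange_div_aux (hx : Real.exp 16 ≤ x) (hy4 : Real.log x ^ 4 ≤ y)
    (hylog : Real.log y ≤ Real.log x ^ (1 / 5 : ℝ)) (hg1 : 1 ≤ g) (hg : g ≤ x ^ (1 / 2 : ℝ)) :
    x ^ (1 / 2 : ℝ) ≤ x / g ∧ x / g ≤ x ∧ 1 < x / g ∧ Real.log x / 2 ≤ Real.log (x / g) ∧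
      Real.log (x / g) ≤ Real.log x ∧ Real.log (x / g) ^ 3 ≤ y ∧ (y : ℝ) ≤ x / g := by
  obtain ⟨-, hx1, hy2, -, hy3, hyx, -⟩ := scaleRange_aux hx hy4 hylog
  have hx0 : 0 < x := by linarith
  have hg0 : 0 < g := by linarith
  have hsqrt0 : 0 < x ^ (1 / 2 : ℝ) := Real.rpow_pos_of_pos hx0 _
  have hsq : x ^ (1 / 2 : ℝ) * x ^ (1 / 2 : ℝ) = x := by
    rw [← Real.rpow_add hx0]; norm_num
  have h1 : x ^ (1 / 2 : ℝ) ≤ x / g := by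
    rw [le_div_iff₀ hg0]
    calc x ^ (1 / 2 : ℝ) * g ≤ x ^ (1 / 2 : ℝ) * x ^ (1 / 2 : ℝ) :=
          mul_le_mul_of_nonneg_left hg hsqrt0.le
      _ = x := hsq
  have h2 : x / g ≤ x := div_le_self hx0.le hg1
  have hz0 : 0 < x / g := div_pos hx0 hg0
  have hy2r : (2 : ℝ) ≤ y := by exact_mod_cast hy2
  have h3 : 1 < x / g := by linarith
  have hlogg : Real.log g ≤ Real.log x / 2 := by
    calc Real.log g ≤ Real.log (x ^ (1 / 2 : ℝ)) := Real.log_le_log hg0 hg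
      _ = Real.log x / 2 := by rw [Real.log_rpow hx0]; ring
  have hlogz : Real.log (x / g) = Real.log x - Real.log g := Real.log_div hx0.ne' hg0.ne'
  have h4 : Real.log x / 2 ≤ Real.log (x / g) := by rw [hlogz]; linarith
  have h5 : Real.log (x / g) ≤ Real.log x := Real.log_le_log hz0 h2
  have hlogz0 : 0 ≤ Real.log (x / g) := (Real.log_nonneg hg1).trans (by linarith)
  have h6 : Real.log (x / g) ^ 3 ≤ y := (pow_le_pow_left₀ hlogz0 h5 3).trans hy3
  exact ⟨h1, h2, h3, h4, h5, h6, hyx.trans h1⟩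

/-! ### `φ₂` at the saddle points of `x` and of `x/g` -/

/-- **`φ₂(α(x/g, y), y) ≤ φ₂(α(x, y), y)`** for `1 ≤ g < x`, `y ≥ 2`: `α(·, y)` is decreasing
(`saddlePoint_antitone`, [Harper2016, §2.1]) so `α(x, y) ≤ α(x/g, y)`, and `φ₂(·, y)` is decreasing
(`saddlePhi₂_antitoneOn`). [cite: Harper2016, §2.1 (remark after (2.1))] -/
theorem saddlePhi₂_saddlePoint_div_le (hxg : 1 < x / g) (hg1 : 1 ≤ g) (hy : 2 ≤ y) :
    saddlePoint x y ≤ saddlePoint (x / g) y ∧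
      saddlePhi₂ (saddlePoint (x / g) y) y ≤ saddlePhi₂ (saddlePoint x y) y := by
  have hg0 : 0 < g := by linarith
  have hx0 : 0 < x := by
    have h := mul_pos (lt_trans one_pos hxg) hg0
    rwa [div_mul_cancel₀ x hg0.ne'] at h
  have hxgx : x / g ≤ x := div_le_self hx0.le hg1
  have hx1 : 1 < x := lt_of_lt_of_le hxg hxgx
  have hle : saddlePoint x y ≤ saddlePoint (x / g) y := saddlePoint_antitone hxg hxgx hy
  exact ⟨hle, saddlePhi₂_antitoneOn (saddlePoint_pos hx1 hy) (saddlePoint_pos hxg hy) hle⟩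

/-- **`φ₂(α(x, y), y) ≤ C φ₂(α(x/g, y), y)` for `1 ≤ g ≤ √x`** in the range `x ≥ x₀`, `(log x)^4 ≤ y`,
`log y ≤ (log x)^{1/5}` (`C` absolute): both `x` and `x/g ≥ √x` lie in the range of
Hildebrand–Tenenbaum's `φ₂(α(z, y), y) ≍ log z · log y` [Thm 2 (2.5); here the tree's
`le_saddlePhi₂_saddlePoint` at `z = x/g` and `saddlePhi₂_saddlePoint_le` at `z = x`], and
`log(x/g) ≥ (log x)/2`; so `φ₂(α(x)) ≤ 3 log x log y ≤ (6/c) · c log(x/g) log y ≤ (6/c) φ₂(α(x/g))`.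
[cite: HildebrandTenenbaum1986, Thm 2 (2.5)] -/
theorem saddlePhi₂_saddlePoint_le_mul_div :
    ∃ C x₀ : ℝ, 0 < C ∧ ∀ (x : ℝ) (y : ℕ), x₀ ≤ x → Real.log x ^ 4 ≤ y →
      Real.log y ≤ Real.log x ^ (1 / 5 : ℝ) → ∀ g : ℝ, 1 ≤ g → g ≤ x ^ (1 / 2 : ℝ) →
        saddlePhi₂ (saddlePoint x y) y ≤ C * saddlePhi₂ (saddlePoint (x / g) y) y := by
  obtain ⟨c, x_φ, hc, hφlo⟩ := le_saddlePhi₂_saddlePoint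
  obtain ⟨x_φ', hφhi⟩ := saddlePhi₂_saddlePoint_le
  refine ⟨6 / c, max (Real.exp 16) (max (x_φ ^ 2) x_φ'), by positivity,
    fun x y hx hy4 hylog g hg1 hg => ?_⟩
  have hx16 : Real.exp 16 ≤ x := le_trans (le_max_left _ _) hx
  have hxφ2 : x_φ ^ 2 ≤ x := le_trans (le_trans (le_max_left _ _) (le_max_right _ _)) hx
  have hxφ' : x_φ' ≤ x := le_trans (le_trans (le_max_right _ _) (le_max_right _ _)) hx
  obtain ⟨-, -, -, hlogy, hy3, hyx, hxx⟩ := scaleRange_aux hx16 hy4 hylog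
  obtain ⟨h1, -, -, h4, -, h6, h7⟩ := scaleRange_div_aux hx16 hy4 hylog hg1 hg
  -- `x_φ ≤ √x ≤ x/g`
  have hxφ : x_φ ≤ x / g := by
    have : x_φ ≤ x ^ (1 / 2 : ℝ) := by
      calc x_φ ≤ |x_φ| := le_abs_self _
        _ = Real.sqrt (x_φ ^ 2) := (Real.sqrt_sq_eq_abs _).symm
        _ ≤ Real.sqrt x := Real.sqrt_le_sqrt hxφ2
        _ = x ^ (1 / 2 : ℝ) := Real.sqrt_eq_rpow x
    exact this.trans h1
  have hlo := hφlo (x / g) y hxφ h6 h7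
  have hhi := hφhi x y hxφ' hy3 (hyx.trans hxx)
  calc saddlePhi₂ (saddlePoint x y) y ≤ 3 * Real.log x * Real.log y := hhi
    _ = 6 / c * (c * (Real.log x / 2 * Real.log y)) := by field_simp; ring
    _ ≤ 6 / c * (c * (Real.log (x / g) * Real.log y)) := by gcongr
    _ ≤ 6 / c * saddlePhi₂ (saddlePoint (x / g) y) y := by gcongr

/-! ### The saddle size `𝓟(x/g)` against `g^{-α} 𝓟(x)` -/

/-- **The saddle size at a divided scale**: with `𝓟(z) = z^{α(z,y)} ζ(α(z,y), y)/√φ₂(α(z,y), y)`,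
**`𝓟(x/g) ≤ C g^{-α(x,y)} 𝓟(x)`** for `x ≥ x₀`, `(log x)^4 ≤ y`, `log y ≤ (log x)^{1/5}` and real
`1 ≤ g ≤ √x` (`C` absolute). Numerator: "`min_{σ>0} x^σ ζ(σ, y)` … is attained for `σ = α`"
[HildebrandTenenbaum1986, §2 after (2.1)] at the scale `x/g` with the competitor `σ = α(x, y)`:
`(x/g)^{α(x/g)} ζ(α(x/g), y) ≤ (x/g)^{α} ζ(α, y) = g^{-α} x^{α} ζ(α, y)` (`rpow_mul_smoothZeta_saddlePoint_le`);
denominator: `φ₂(α(x), y) ≤ C' φ₂(α(x/g), y)` (`saddlePhi₂_saddlePoint_le_mul_div`), `C = √C'`.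
[cite: HildebrandTenenbaum1986, §2 (2.1)–(2.2) and Thm 2 (2.5)] -/
theorem saddleSize_div_le :
    ∃ C x₀ : ℝ, 0 < C ∧ ∀ (x : ℝ) (y : ℕ), x₀ ≤ x → Real.log x ^ 4 ≤ y →
      Real.log y ≤ Real.log x ^ (1 / 5 : ℝ) → ∀ g : ℝ, 1 ≤ g → g ≤ x ^ (1 / 2 : ℝ) →
        (x / g) ^ saddlePoint (x / g) y * smoothZeta (saddlePoint (x / g) y) y /
            Real.sqrt (saddlePhi₂ (saddlePoint (x / g) y) y) ≤
          C * g ^ (-saddlePoint x y) *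
            (x ^ saddlePoint x y * smoothZeta (saddlePoint x y) y /
              Real.sqrt (saddlePhi₂ (saddlePoint x y) y)) := by
  obtain ⟨C, x₀, hC, hcmp⟩ := saddlePhi₂_saddlePoint_le_mul_div
  refine ⟨Real.sqrt C, max x₀ (Real.exp 16), Real.sqrt_pos.2 hC, fun x y hx hy4 hylog g hg1 hg => ?_⟩
  have hx₀ : x₀ ≤ x := le_trans (le_max_left _ _) hx
  have hx16 : Real.exp 16 ≤ x := le_trans (le_max_right _ _) hx
  obtain ⟨-, hx1, hy2, -, -, -, -⟩ := scaleRange_aux hx16 hy4 hylog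
  obtain ⟨-, -, hz1, -, -, -, -⟩ := scaleRange_div_aux hx16 hy4 hylog hg1 hg
  have hx0 : 0 < x := by linarith
  have hg0 : 0 < g := by linarith
  set α := saddlePoint x y with hα
  set αg := saddlePoint (x / g) y with hαg
  have hα0 : 0 < α := saddlePoint_pos hx1 hy2
  have hαg0 : 0 < αg := saddlePoint_pos hz1 hy2
  set S := Real.sqrt (saddlePhi₂ α y) with hS
  set Sg := Real.sqrt (saddlePhi₂ αg y) with hSg
  have hS0 : 0 < S := Real.sqrt_pos.2 (saddlePhi₂_pos hy2 hα0)
  have hSg0 : 0 < Sg := Real.sqrt_pos.2 (saddlePhi₂_pos hy2 hαg0)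
  -- numerator: minimality of Rankin's bound at the saddle point of `x/g`, competitor `σ = α`
  have hnum : (x / g) ^ αg * smoothZeta αg y ≤ g ^ (-α) * (x ^ α * smoothZeta α y) := by
    have h := rpow_mul_smoothZeta_saddlePoint_le (x := x / g) (y := y) hz1 hy2 hα0
    have heq : (x / g) ^ α = g ^ (-α) * x ^ α := by
      rw [Real.div_rpow hx0.le hg0.le, Real.rpow_neg hg0.le, div_eq_mul_inv, mul_comm]
    calc (x / g) ^ αg * smoothZeta αg y ≤ (x / g) ^ α * smoothZeta α y := h
      _ = g ^ (-α) * (x ^ α * smoothZeta α y) := by rw [heq, mul_assoc]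
  -- denominator: `S ≤ √C · Sg`
  have hden : S ≤ Real.sqrt C * Sg := by
    rw [hS, hSg, ← Real.sqrt_mul hC.le]
    exact Real.sqrt_le_sqrt (hcmp x y hx₀ hy4 hylog g hg1 hg)
  have hN0 : 0 ≤ g ^ (-α) * (x ^ α * smoothZeta α y) := by
    have := smoothZeta_pos (y := y) hα0
    positivity
  calc (x / g) ^ αg * smoothZeta αg y / Sg ≤ g ^ (-α) * (x ^ α * smoothZeta α y) / Sg :=
        div_le_div_of_nonneg_right hnum hSg0.le
    _ = g ^ (-α) * (x ^ α * smoothZeta α y) * (1 / Sg) := by ring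
    _ ≤ g ^ (-α) * (x ^ α * smoothZeta α y) * (Real.sqrt C / S) := by
        refine mul_le_mul_of_nonneg_left ?_ hN0
        rw [div_le_div_iff₀ hSg0 hS0, one_mul]
        exact hden
    _ = Real.sqrt C * g ^ (-α) * (x ^ α * smoothZeta α y / S) := by ring

/-- **The saddle size at a divided scale, natural divisor**: `𝓟(x/g) ≤ C g^{-α(x,y)} 𝓟(x)` for
`g : ℕ`, `1 ≤ g ≤ √x`, in the range `x ≥ x₀`, `(log x)^4 ≤ y`, `log y ≤ (log x)^{1/5}`.
[cite: HildebrandTenenbaum1986, §2 (2.1)–(2.2) and Thm 2 (2.5)] -/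
theorem saddleSize_div_nat_le :
    ∃ C x₀ : ℝ, 0 < C ∧ ∀ (x : ℝ) (y : ℕ), x₀ ≤ x → Real.log x ^ 4 ≤ y →
      Real.log y ≤ Real.log x ^ (1 / 5 : ℝ) → ∀ g : ℕ, 1 ≤ g → (g : ℝ) ≤ x ^ (1 / 2 : ℝ) →
        (x / g) ^ saddlePoint (x / g) y * smoothZeta (saddlePoint (x / g) y) y /
            Real.sqrt (saddlePhi₂ (saddlePoint (x / g) y) y) ≤
          C * (g : ℝ) ^ (-saddlePoint x y) *
            (x ^ saddlePoint x y * smoothZeta (saddlePoint x y) y /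
              Real.sqrt (saddlePhi₂ (saddlePoint x y) y)) := by
  obtain ⟨C, x₀, hC, h⟩ := saddleSize_div_le
  exact ⟨C, x₀, hC, fun x y hx hy4 hylog g hg1 hg => h x y hx hy4 hylog g (Nat.one_le_cast.2 hg1) hg⟩

/-! ### The counting form -/

/-- **`Ψ(x/g, y) ≤ 50 √(φ₂(α, y)) g^{-α} Ψ(x, y) ≤ 50 √(3 log x log y) g^{-α} Ψ(x, y)`**, `α = α(x, y)`,
for `x ≥ x₀`, `(log x)^4 ≤ y`, `log y ≤ (log x)^{1/5}` and EVERY real `g > 0`: Rankin at the master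
saddle point (`Ψ(x/g, y) ≤ g^{-α} x^α ζ(α, y)`), the lower half `x^α ζ(α, y)/√φ₂(α, y) ≤ 50 Ψ(x, y)` of
Hildebrand–Tenenbaum's Theorem 1 (`card_smoothNumbersUpTo_two_sided`) and `φ₂(α, y) ≤ 3 log x log y`
(`saddlePhi₂_saddlePoint_le`). A crude form (losing `√(log x log y)`) of "Smooth Numbers Result 2"
`Ψ(x/d, y) ≪ d^{-α} Ψ(x, y)` [Harper2016, §2.1]. [cite: HildebrandTenenbaum1986, Thm 1 and §2 (2.1)] -/
theorem card_smoothNumbersUpTo_div_le_mul_card :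
    ∃ x₀ : ℝ, ∀ (x : ℝ) (y : ℕ), x₀ ≤ x → Real.log x ^ 4 ≤ y →
      Real.log y ≤ Real.log x ^ (1 / 5 : ℝ) → ∀ g : ℝ, 0 < g →
        ((Nat.smoothNumbersUpTo ⌊x / g⌋₊ (y + 1)).card : ℝ) ≤
            50 * Real.sqrt (saddlePhi₂ (saddlePoint x y) y) * g ^ (-saddlePoint x y) *
              ((Nat.smoothNumbersUpTo ⌊x⌋₊ (y + 1)).card : ℝ) ∧
        ((Nat.smoothNumbersUpTo ⌊x / g⌋₊ (y + 1)).card : ℝ) ≤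
            50 * Real.sqrt (3 * Real.log x * Real.log y) * g ^ (-saddlePoint x y) *
              ((Nat.smoothNumbersUpTo ⌊x⌋₊ (y + 1)).card : ℝ) := by
  obtain ⟨x₁, hΨ⟩ := card_smoothNumbersUpTo_two_sided
  obtain ⟨x_φ', hφhi⟩ := saddlePhi₂_saddlePoint_le
  refine ⟨max x₁ (max x_φ' (Real.exp 16)), fun x y hx hy4 hylog g hg0 => ?_⟩
  have hx₁ : x₁ ≤ x := le_trans (le_max_left _ _) hx
  have hxφ' : x_φ' ≤ x := le_trans (le_trans (le_max_left _ _) (le_max_right _ _)) hx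
  have hx16 : Real.exp 16 ≤ x := le_trans (le_trans (le_max_right _ _) (le_max_right _ _)) hx
  obtain ⟨-, hx1, hy2, -, hy3, hyx, hxx⟩ := scaleRange_aux hx16 hy4 hylog
  set α := saddlePoint x y with hα
  have hα0 : 0 < α := saddlePoint_pos hx1 hy2
  set S := Real.sqrt (saddlePhi₂ α y) with hS
  have hS0 : 0 < S := Real.sqrt_pos.2 (saddlePhi₂_pos hy2 hα0)
  set Ψ : ℝ := ((Nat.smoothNumbersUpTo ⌊x⌋₊ (y + 1)).card : ℝ) with hΨdef
  obtain ⟨hlow, -⟩ := hΨ x y hx₁ hy4 hylog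
  -- `x^α ζ(α, y) ≤ 50 S Ψ`
  have hmain : x ^ α * smoothZeta α y ≤ 50 * S * Ψ := by
    have h1 : x ^ α * smoothZeta α y / S ≤ 50 * Ψ := by linarith
    rw [div_le_iff₀ hS0] at h1
    linarith
  have hR := card_smoothNumbersUpTo_div_le_rankin_saddlePoint (y := y) hx1 hy2 hg0
  have hgα : 0 ≤ g ^ (-α) := Real.rpow_nonneg hg0.le _
  have hA : ((Nat.smoothNumbersUpTo ⌊x / g⌋₊ (y + 1)).card : ℝ) ≤ 50 * S * g ^ (-α) * Ψ := by
    calc ((Nat.smoothNumbersUpTo ⌊x / g⌋₊ (y + 1)).card : ℝ) ≤ g ^ (-α) * (x ^ α * smoothZeta α y) := hR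
      _ ≤ g ^ (-α) * (50 * S * Ψ) := mul_le_mul_of_nonneg_left hmain hgα
      _ = 50 * S * g ^ (-α) * Ψ := by ring
  have hSle : S ≤ Real.sqrt (3 * Real.log x * Real.log y) :=
    Real.sqrt_le_sqrt (hφhi x y hxφ' hy3 (hyx.trans hxx))
  exact ⟨hA, hA.trans (mul_le_mul_of_nonneg_right (mul_le_mul_of_nonneg_right
    (mul_le_mul_of_nonneg_left hSle (by norm_num)) hgα) (Nat.cast_nonneg _))⟩

/-! ### Packaging for natural divisors -/

/-- **Scale comparison, packaged** (natural divisors `g ≥ 1`; one absolute constant `C`, one threshold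
`x₀`). For `x ≥ x₀`, `(log x)^4 ≤ y`, `log y ≤ (log x)^{1/5}`, with `α = α(x, y)`: `x > 1`, `y ≥ 2`,
`α > 0`, `0 < φ₂(α, y) ≤ 3 log x log y`, and for every `g ≥ 1`:
(R1) `Ψ(x/g, y) ≤ g^{-α} x^α ζ(α, y)`; (R3) `Ψ(x/g, y) ≤ 50 √(3 log x log y) g^{-α} Ψ(x, y)`; and if
moreover `g ≤ √x`: `x/g > 1`, `α ≤ α(x/g, y)`, `φ₂(α(x/g), y) ≤ φ₂(α, y) ≤ C φ₂(α(x/g), y)` and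
(R2) `𝓟(x/g) ≤ C g^{-α} 𝓟(x)`, `𝓟(z) = z^{α(z,y)} ζ(α(z,y), y)/√φ₂(α(z,y), y)`.
[cite: HildebrandTenenbaum1986, Thm 1, §2 (2.1)–(2.2) and Thm 2 (2.5)] -/
theorem scale_compare :
    ∃ C x₀ : ℝ, 0 < C ∧ ∀ (x : ℝ) (y : ℕ), x₀ ≤ x → Real.log x ^ 4 ≤ y →
      Real.log y ≤ Real.log x ^ (1 / 5 : ℝ) →
      1 < x ∧ 2 ≤ y ∧ 0 < saddlePoint x y ∧ 0 < saddlePhi₂ (saddlePoint x y) y ∧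
      saddlePhi₂ (saddlePoint x y) y ≤ 3 * Real.log x * Real.log y ∧
      ∀ g : ℕ, 1 ≤ g →
        ((Nat.smoothNumbersUpTo ⌊x / g⌋₊ (y + 1)).card : ℝ) ≤
            (g : ℝ) ^ (-saddlePoint x y) * (x ^ saddlePoint x y * smoothZeta (saddlePoint x y) y) ∧
        ((Nat.smoothNumbersUpTo ⌊x / g⌋₊ (y + 1)).card : ℝ) ≤
            50 * Real.sqrt (3 * Real.log x * Real.log y) * (g : ℝ) ^ (-saddlePoint x y) *
              ((Nat.smoothNumbersUpTo ⌊x⌋₊ (y + 1)).card : ℝ) ∧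
        ((g : ℝ) ≤ x ^ (1 / 2 : ℝ) →
          1 < x / g ∧ saddlePoint x y ≤ saddlePoint (x / g) y ∧
          saddlePhi₂ (saddlePoint (x / g) y) y ≤ saddlePhi₂ (saddlePoint x y) y ∧
          saddlePhi₂ (saddlePoint x y) y ≤ C * saddlePhi₂ (saddlePoint (x / g) y) y ∧
          (x / g) ^ saddlePoint (x / g) y * smoothZeta (saddlePoint (x / g) y) y /
              Real.sqrt (saddlePhi₂ (saddlePoint (x / g) y) y) ≤
            C * (g : ℝ) ^ (-saddlePoint x y) *
              (x ^ saddlePoint x y * smoothZeta (saddlePoint x y) y /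
                Real.sqrt (saddlePhi₂ (saddlePoint x y) y))) := by
  obtain ⟨C₁, x₁, hC₁, hφ⟩ := saddlePhi₂_saddlePoint_le_mul_div
  obtain ⟨C₂, x₂, hC₂, hP⟩ := saddleSize_div_le
  obtain ⟨x₃, hΨ⟩ := card_smoothNumbersUpTo_div_le_mul_card
  obtain ⟨x_φ', hφhi⟩ := saddlePhi₂_saddlePoint_le
  refine ⟨max C₁ C₂, max (max x₁ x₂) (max x₃ (max x_φ' (Real.exp 16))), lt_max_of_lt_left hC₁,
    fun x y hx hy4 hylog => ?_⟩
  have hx₁ : x₁ ≤ x := le_trans (le_trans (le_max_left _ _) (le_max_left _ _)) hx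
  have hx₂ : x₂ ≤ x := le_trans (le_trans (le_max_right _ _) (le_max_left _ _)) hx
  have hx₃ : x₃ ≤ x := le_trans (le_trans (le_max_left _ _) (le_max_right _ _)) hx
  have hxφ' : x_φ' ≤ x :=
    le_trans (le_trans (le_trans (le_max_left _ _) (le_max_right _ _)) (le_max_right _ _)) hx
  have hx16 : Real.exp 16 ≤ x :=
    le_trans (le_trans (le_trans (le_max_right _ _) (le_max_right _ _)) (le_max_right _ _)) hx
  obtain ⟨-, hx1, hy2, -, hy3, hyx, hxx⟩ := scaleRange_aux hx16 hy4 hylog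
  have hα0 : 0 < saddlePoint x y := saddlePoint_pos hx1 hy2
  refine ⟨hx1, hy2, hα0, saddlePhi₂_pos hy2 hα0, hφhi x y hxφ' hy3 (hyx.trans hxx), fun g hg1 => ?_⟩
  have hg1r : (1 : ℝ) ≤ g := Nat.one_le_cast.2 hg1
  have hg0 : (0 : ℝ) < g := by linarith
  refine ⟨card_smoothNumbersUpTo_div_le_rankin_saddlePoint hx1 hy2 hg0,
    (hΨ x y hx₃ hy4 hylog g hg0).2, fun hg => ?_⟩
  obtain ⟨-, -, hz1, -, -, -, -⟩ := scaleRange_div_aux hx16 hy4 hylog hg1r hg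
  obtain ⟨hαle, hφle⟩ := saddlePhi₂_saddlePoint_div_le (y := y) hz1 hg1r hy2
  have hφg0 : 0 ≤ saddlePhi₂ (saddlePoint (x / g) y) y := saddlePhi₂_nonneg _ _
  refine ⟨hz1, hαle, hφle, ?_, ?_⟩
  · exact (hφ x y hx₁ hy4 hylog g hg1r hg).trans
      (mul_le_mul_of_nonneg_right (le_max_left _ _) hφg0)
  · have h1 : 0 ≤ (g : ℝ) ^ (-saddlePoint x y) := Real.rpow_nonneg hg0.le _
    have h2 : 0 ≤ x ^ saddlePoint x y * smoothZeta (saddlePoint x y) y /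
        Real.sqrt (saddlePhi₂ (saddlePoint x y) y) := by
      have := smoothZeta_pos (y := y) hα0
      positivity
    exact (hP x y hx₂ hy4 hylog g hg1r hg).trans
      (mul_le_mul_of_nonneg_right (mul_le_mul_of_nonneg_right (le_max_right _ _) h1) h2)

end Literature.NumberTheory.Sieve

end
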